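import Summits.FinalStateConjecture.FinalStateConjecture.Theorems.EIHFluxBalanceModulatedKerrHandoffTameDefs
import Summits.FinalStateConjecture.FinalStateConjecture.Theorems.PhaseMixingCaptureCaptureSufficesC2SettlingTransport
import Literature.Geometry.Lorentzian.CauchyDevelopmentPrecomp
import Literature.Geometry.Lorentzian.AFEndUnbreathe
import Literature.Geometry.Lorentzian.AFEndBreathingData
import HarnessLib

/-!
# `EIHFluxBalance.ModulatedKerrHandoff` (item stmt-FinalStateConjecture-17402, H′ — the TAME re-type):
# the handoff property is invariant under RE-INDEXING THE DATA by a diffeomorphism (transport along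
# `VacuumCauchyDevelopment.precomp`), in particular under breathing

Line `Sketch` (tame template breathe ∘ trim ∘ kick; skeleton `Cruxes/ModulatedKerrHandoff/Lines/Sketch.lean`),
lead prover `prover-line-stmt-FinalStateConjecture-17402-0`, 2026-08-17.

`Literature/Geometry/Lorentzian/CauchyDevelopmentPrecomp.lean` re-indexes a vacuum Cauchy development
`𝒟 = (M, g, τ, ι, ν)` of `D` along a diffeomorphism `Φ` of `X` to the development
`𝒟.precomp Φ = (M, g, τ, ι ∘ Φ, ν ∘ Φ)` of `Φ^* D` (same spacetime) and proves that maximality, MGHD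
existence and complete `𝓘⁺` are invariant. This file adds the 17 development-level clauses of the crux
(`HandoffClause`, `…TameDefs.lean`): of them only `O = exteriorOf …` (through `range ι`, unchanged) and
`RaysStayInClosure` (through the family of normalised null rays from the points of `Σ`, re-indexed by
`Φ`) read the data embedding — both already transported in
`Theorems/PhaseMixingCaptureCaptureSufficesC2SettlingTransport.lean` (`exteriorOf_precomp`,
`raysStayInClosure_precomp_iff`).

* `handoffClause_precomp_iff` — the handoff clause of `𝒟.precomp Φ` iff of `𝒟`;
* `handoffPropT_comap_iff` — `HandoffPropT X (Φ^* D) ↔ HandoffPropT X D`;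
* `handoffPropT_breatheFamily`, `handoffPropT_breatheFamily_iff` — in particular along the breathing
  diffeomorphisms of `AFEndBreathing*.lean` (`E_t = (breathe (σ t))^* d`), the gauge leg of every tame
  witness template of the crux (breathing restores immersion and injectivity of a tame curve).

References: Y. Choquet-Bruhat, R. Geroch, CMP 14 (1969), p. 330 (diffeomorphism covariance of
developments); J. M. Lee, *Introduction to Smooth Manifolds* (2013), Prop. 2.25.
-/

set_option linter.dupNamespace false

noncomputable section

namespace Summit.FinalStateConjecture.FinalStateConjecture.Theorems.EIHFluxBalance.TameTemplate

open scoped Topology Manifold ContDiff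
open Filter Set Function TopologicalSpace Literature.Geometry.Lorentzian InitialDataSet
open Summit.FinalStateConjecture.FinalStateConjecture.Theorems.PhaseMixingCaptureCaptureSufficesC2
  (raysStayInClosure_precomp_iff exteriorOf_precomp injective_mfderiv_homeomorph_symm)

/-! ## Transport of the handoff clause along re-indexing of the data -/

section Transport

variable {X : Type} [TopologicalSpace X] [ChartedSpace E3 X] [IsManifold (𝓡 3) ((⊤ : ℕ∞) : WithTop ℕ∞) X] [T2Space X] [SecondCountableTopology X] [ConnectedSpace X]
  {D : InitialDataSet (𝓡 3) X} (𝒟 : VacuumCauchyDevelopment D) (Φ : X ≃ₜ X)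
  (hΦ : ContMDiff (𝓡 3) (𝓡 3) (∞ + 1) Φ) (hΦ' : ∀ u, Injective (mfderiv (𝓡 3) (𝓡 3) Φ u))

/-- **The handoff clause of the re-indexed development iff of the original.** The spacetime, the lab
chart data `(N, M, a, rin, Λ, ξ, γ, κ, τ₀, U, Φ, O)` and every clause are literally the same for
`𝒟.precomp Φ` and `𝒟`, except the two that read the data embedding: `O = exteriorOf …` (through
`range ι`, unchanged: `exteriorOf_precomp`) and `RaysStayInClosure` (rays from `p` for `ι ∘ Φ` are rays
from `Φ p` for `ι`: `raysStayInClosure_precomp_iff`); complete `𝓘⁺` by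
`hasCompleteFutureNullInfinity_precomp_iff`. [cite: ChoquetBruhatGeroch1969CMP, p. 330] -/
theorem handoffClause_precomp_iff :
    HandoffClause X (D.comap Φ hΦ hΦ') (𝒟.precomp Φ hΦ hΦ') ↔ HandoffClause X D 𝒟 := by
  unfold HandoffClause
  refine and_congr (𝒟.hasCompleteFutureNullInfinity_precomp_iff Φ hΦ hΦ') ?_
  simp only [exteriorOf_precomp, raysStayInClosure_precomp_iff]
  exact Iff.rfl

/-- **The handoff property is invariant under re-indexing the data by a diffeomorphism**
(`exists_isMaximal_comap_iff` and `forall_isMaximal_comap_iff` fed with `handoffClause_precomp_iff`).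
[cite: ChoquetBruhatGeroch1969CMP, p. 330] -/
theorem handoffPropT_comap_iff (hΨ : ContMDiff (𝓡 3) (𝓡 3) (∞ + 1) Φ.symm)
    (hΨ' : ∀ u, Injective (mfderiv (𝓡 3) (𝓡 3) Φ.symm u)) :
    HandoffPropT X (D.comap Φ hΦ hΦ') ↔ HandoffPropT X D := by
  unfold HandoffPropT
  refine and_congr (VacuumCauchyDevelopment.exists_isMaximal_comap_iff Φ hΦ hΦ' hΨ hΨ') ?_
  exact VacuumCauchyDevelopment.forall_isMaximal_comap_iff Φ hΦ hΦ' hΨ hΨ'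
    (fun {D'} 𝒟 ↦ HandoffClause X D' 𝒟) fun 𝒟 Θ hΘ hΘ' ↦ handoffClause_precomp_iff 𝒟 Θ hΘ hΘ'

end Transport

section Breathe

variable {X : Type} [TopologicalSpace X] [ChartedSpace E3 X] [IsManifold (𝓡 3) ((⊤ : ℕ∞) : WithTop ℕ∞) X] [T2Space X] [SecondCountableTopology X] [ConnectedSpace X]
  {e : AFEnd X} {z₀ : E3} {r : ℝ} (B : AFEnd.BreathingData e z₀ r) (d : InitialDataSet (𝓡 3) X)

/-- **The handoff property passes between `d` and every member of its breathing family**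
(`E_t = (breathe (σ t))^* d` is the re-indexing of `d` by a diffeomorphism of `X`).
[cite: LeeSmoothManifolds2013, Prop. 2.25] -/
theorem handoffPropT_breatheFamily (t : ℝ) :
    HandoffPropT X (AFEnd.breatheFamily B d t) ↔ HandoffPropT X d := by
  set Φ : X ≃ₜ X := AFEnd.breatheHomeomorph B (AFEnd.abs_squash_lt_invScale B t) with hΦdef
  have hΦ : ContMDiff (𝓡 3) (𝓡 3) (∞ + 1) Φ :=
    AFEnd.contMDiff_breathe_succ B (AFEnd.abs_squash_lt_scale B t).2
  have hΦ' : ∀ u, Injective (mfderiv (𝓡 3) (𝓡 3) Φ u) :=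
    (AFEnd.breatheScale_spec B).2.2 _ (AFEnd.abs_squash_lt_scale B t).1
  have hΨ : ContMDiff (𝓡 3) (𝓡 3) (∞ + 1) Φ.symm := AFEnd.contMDiff_unbreathe B _
  have hΨ' : ∀ u, Injective (mfderiv (𝓡 3) (𝓡 3) Φ.symm u) :=
    injective_mfderiv_homeomorph_symm Φ hΦ hΨ
  have key : AFEnd.breatheFamily B d t = d.comap Φ hΦ hΦ' := rfl
  rw [key]
  exact handoffPropT_comap_iff Φ hΦ hΦ' hΨ hΨ'

end Breathe

/-- **The handoff property is invariant under breathing** (closed `∀`-form of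
`handoffPropT_breatheFamily`, the registered anchor of this file). [cite: LeeSmoothManifolds2013, Prop. 2.25] -/
theorem handoffPropT_breatheFamily_iff :
    ∀ (X : Type) [TopologicalSpace X] [ChartedSpace E3 X] [IsManifold (𝓡 3) ((⊤ : ℕ∞) : WithTop ℕ∞) X] [T2Space X] [SecondCountableTopology X] [ConnectedSpace X] (e : AFEnd X) (z₀ : E3) (r : ℝ) (B : AFEnd.BreathingData e z₀ r) (d : InitialDataSet (𝓡 3) X) (t : ℝ), HandoffPropT X (AFEnd.breatheFamily B d t) ↔ HandoffPropT X d :=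
  fun _ _ _ _ _ _ _ _ _ _ B d t ↦ handoffPropT_breatheFamily B d t

end Summit.FinalStateConjecture.FinalStateConjecture.Theorems.EIHFluxBalance.TameTemplate

end
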